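/-
Copyright (c) 2026 the pub-hodgecm-mathlib formalisation cell (harness21).  Prover seat hodgecm-mathlib-A-p17 (g19), floor 0, programme P5
(Alb-CM), row «L4if-B2» (desk F0P5-plan (g4), 2026-08-31).  KERNEL module: THEOREMS ONLY (no definition, no named fact, no `sorry`, no
instance, no notation).
-/
import Summits.HodgeConjecture.HodgeConjecture.Theorems.F0P5CurveThetaCompanionLocalDetTwistPair
import Summits.HodgeConjecture.HodgeConjecture.Theorems.F0P5CurveThetaCompanionDetTwistRep
import Literature.NumberTheory.GelbartRogawski1991.DoubledWeilRepresentationCMExplicit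
import HarnessLib

/-!
# F0 · P5 pay-down line `Cruxes/HLiu418/Lines/F0_P5_CurveThetaLettersPaydown` (ED. 7), letter L4if, brick B2 (file 2 of 2):
# the companion relabel `λ ↦ λ′ = λᶜ·χ̌` is a determinant twist PLACE BY PLACE — the LOCAL Weil factors of the two
# CM θ-packages on one line differ by the character `α_v ∘ det` ([Liu2021, Lem. D.1 (4)]; [GelbartRogawski1991, §3.1 Remark p. 457])

Cell `hodgecm-mathlib`, floor 0, programme P5 (Alb-CM); crux item `stmt-HodgeConjecture-24832`
(`Summit.HodgeConjecture.HodgeConjecture.Theses.HCCMUnconditional.HLiu418`).  Sequel of ★ `F0P5CurveThetaCompanionLocalDetTwistPair` (§1 the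
PAIR FORM `Ω_{θ′}(reindex(k ⊗ u)) = α(det((1,k) ⊗ (1,u))) • Ω_θ(reindex(k ⊗ u))`, §2 the slot bookkeeping) and of ★ `F0P5CurveThetaCompanionDetTwist`
(§1, p828480: the det-twist character `α(u) = Λ(u)⁻¹·χ(u_f)` of R2G and (T1) `Λᶜ·χ̌ = Λ·α̃`).  Brick B2 of the in-house road for the last local letter
L4if of #74 (memo `F0/P5/A-p18/g23/CENSUS-L4if-inhouse-road.A-p18g23.md` §1 (R-b)): the open-kernel character `η_v` of ★
`LocalSplitting.FinLocalSplittings.exists_twist_omegaLoc` between the local Weil factors of the two θ-packages on one line IS `α_v ∘ det`: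

* §3 **LOCAL FORM** at a finite place `v` (split or not): for unitary Hecke characters `θ`, `θ′ = θ·α̃` with `θ|_{𝕀_{L⁺}} = ε`, ANY per-place
  packages `𝓕`, `𝓕′` of the doubled CM datum on one line `⟨T_W⟩` and any Haar data,
  `ω_{θ′,v}(k ⊗ 1) Φ = α((det k)_v) • ω_{θ,v}(k ⊗ 1) Φ` for every `k ∈ U(diag dV)(L⁺_v)`, `Φ ∈ 𝒮((L⁺_v)^{n′})`
  (`omegaLoc_localLineInl_eq_detTwist_smul_of_mul_ratioHecke`; §1 at `(inclPlace v k, 1)` + §2, the coefficient `α(det((1,k) ⊗ 1)) = α(det (1,k))` by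
  ★ `pairDet_adelicInl`) — `k ↦ k ⊗ 1` being ONTO the big local group (★ `localLineInl_surjective`), this is the whole of `U(diag dV ⊗ ⟨T_W⟩)(L⁺_v)`;
  also as an identity of representations of `U(diag dV)(L⁺_v)` in the currency ★ `SeesawScalar.twist` (`omegaLoc_comp_localLineInl_eq_twist_of_mul_ratioHecke`);
* §4 **the CM COMPANION** (the desk's head `omegaLoc_companion_eq_detTwist_smul`): at the CM θ-packages of [Liu2021, Lem. D.1 (4)] AS TYPED in
  ★ `LemD1RankTwoCMLetters.LemD1_4IfAsPrintedNonsplitCM₂` (`cmFinLocalFamily … (toHeckeCharacter L λ) … (borelPlaceMeasure L)`, rank generic) for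
  conjugate-symplectic `λ, λ′` with `Λ′ = Λᶜ·χ̌` and the ∀-bound twist datum `α(u) = Λ(u)⁻¹·χ(u_f)` of R2G (★ §1 of `F0P5CurveThetaCompanionDetTwist`:
  `continuous_alpha`, `alpha_eq_one_of_mem_principalIdeles`, `norm_alpha`, (T1) `toHeckeCharacter_galConj_mul_checkOfChi_eq_mul_ratioHecke`), at
  EVERY finite place and every line `a ∈ L⁺ˣ`.

HONEST LABEL: HC_CM is proved only modulo the printed citations — the 2 remaining named inputs (hLiu418, h413) — until rung 0 closes; this
file proves helper lemmas (brick B2 of an in-house road) toward ONE registered letter stub (L4if) of ONE floor-0 pay-down line and discharges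
no letter by itself (the ε-dichotomy (D-iso)∕(D-aniso) of [HarrisKudlaSweet1996, Thm. 6.1] and the centre-twist bookkeeping (B1) are NOT
addressed here).

## References
* [Liu2021] Y. Liu, *Fourier–Jacobi cycles and arithmetic relative trace formula*, Camb. J. Math. 9 (2021) = arXiv:2102.11518: Def. 4.11
  (l. 2083–2097), App. D §D.1 Steps 1–3 (l. 5214–5221), §D.1 l. 5224 (`χ̌`), Lem. D.1 (4) (p. 126, l. 5235).
* [GelbartRogawski1991] S. Gelbart, J. Rogawski, *L-functions and Fourier–Jacobi coefficients for the unitary group U(3)*, Invent. Math. 105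
  (1991), §3.1 Prop. 3.1.1 p. 455 L1–3, Remark p. 457 L4–13.
* [HarrisKudlaSweet1996] M. Harris, S. Kudla, W. J. Sweet, *Theta dichotomy for unitary groups*, J. AMS 9 (1996), §1 (1.14)–(1.15).
* [Weil1964] A. Weil, *Sur certains groupes d'opérateurs unitaires*, Acta Math. 111 (1964), Chap. III n° 37–38 pp. 188–190.
-/

set_option autoImplicit false
set_option linter.dupNamespace false

noncomputable section

open NumberField NumberField.InfinitePlace NumberField.mixedEmbedding IsDedekindDomain
open scoped Matrix Kronecker ComplexOrder RestrictedProduct Classical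
open Literature.NumberTheory.Automorphic Literature.NumberTheory.Automorphic.UnitaryGroup
open Literature.NumberTheory.Automorphic.Liu2021 Literature.NumberTheory.Automorphic.Liu2021.Def411WeilCarriers
open Literature.NumberTheory.Automorphic.Liu2021.Def411WeilCarriersDoubling
open Literature.NumberTheory.GaloisRepresentations Literature.NumberTheory.Automorphic.IdeleClassGroup
open Literature.NumberTheory.GelbartRogawski1991 Literature.NumberTheory.GelbartRogawski1991.UnitaryDualPair
open Literature.NumberTheory.GelbartRogawski1991.UnitaryDualPair.WeilCoinv
open Literature.NumberTheory.GelbartRogawski1991.UnitaryDualPair.LocalSplitting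
open Literature.NumberTheory.GelbartRogawski1991.GRConstruction
open Literature.NumberTheory.GelbartRogawski1991.GRConstruction.DoubledWeilDetTwist
open Literature.NumberTheory.Weil1964
open Literature.RepresentationTheory (SeesawScalar.twist SeesawScalar.twist_apply)
open Literature.RepresentationTheory.Liu2021 Literature.RepresentationTheory.HarrisKudlaSweet1996

namespace Summit.HodgeConjecture.HodgeConjecture.Cruxes.HLiu418.F0P5CurveThetaCompanionDetTwist

/-! ## §3 LOCAL FORM: at a finite place `v`, `ω_{θ′,a,v}(k ⊗ 1) = α((det k)_v) • ω_{θ,a,v}(k ⊗ 1)` -/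

section Local

variable (L : Type) [Field L] [NumberField L] [IsCMField L]
variable {N' n' : ℕ} (e₁ : Fin N' × Fin 1 ≃ Fin n')
  (dV₁ : Fin N' → L) (hdV₁ : ∀ i, IsCMField.complexConj L (dV₁ i) = dV₁ i) (hdV₁0 : ∀ i, dV₁ i ≠ 0)
  (hJdet : (Matrix.diagonal dV₁).det ≠ 0)
  (θ : HeckeCharacter L) (hθu : θ.IsUnitary) (hθs : IsSplittingChar L 1 θ)
  {α : UnitaryGroup.adelicOne (Fp L) L (IsCMField.complexConj L) →* ℂˣ} (hc : Continuous α)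
  (hrat : ∀ u : UnitaryGroup.adelicOne (Fp L) L (IsCMField.complexConj L), (u : ideleGroup L) ∈ principalIdeles L → α u = 1)
  (hαu : ∀ u, ‖((α u : ℂˣ) : ℂ)‖ = 1)
  (θ' : HeckeCharacter L) (hθ'u : θ'.IsUnitary) (hθ's : IsSplittingChar L 1 θ')
  (TW : Matrix (Fin 1) (Fin 1) (Fp L)) (hW : TW.IsSymm) (hWd : IsUnit TW.det) (JW : Matrix (Fin 1) (Fin 1) L)
  (hJW : JW = TW.map (algebraMap (Fp L) L))
  (𝔪 𝔪' : ∀ v, PlaceMeasure L v)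
  (𝓕 : FinLocalFamily L e₁ dV₁ hdV₁ hdV₁0 (lineW L TW) (complexConj_lineW L TW) (lineW_ne_zero L TW hWd) θ 𝔪)
  (𝓕' : FinLocalFamily L e₁ dV₁ hdV₁ hdV₁0 (lineW L TW) (complexConj_lineW L TW) (lineW_ne_zero L TW hWd) θ' 𝔪')

include hθu hθs hαu hθ'u hθ's in
set_option maxHeartbeats 800000 in
-- measured (200 k, 400 k] on the check farm; 800 k = 2× head-room for the build lane: the §1 pair identity at `(inclPlace v k, 1)` through the telescopes
/-- **LOCAL FORM — `ω_{θ′,a,v}(k ⊗ 1) Φ = α((det k)_v) • ω_{θ,a,v}(k ⊗ 1) Φ`.**  At every finite place `v` of `L⁺`, for every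
`k ∈ U(diag dV)(L⁺_v)` and `Φ ∈ 𝒮((L⁺_v)^{n′})`, the local Weil representations `ω_v = (𝓢_θ).omegaLoc v`, `ω′_v = (𝓢_{θ′}).omegaLoc v` of the local
undoublings of ANY packages of `θ`, `θ′ = θ·α̃` on one line `⟨T_W⟩` satisfy `ω′_v(k ⊗ 1) Φ = α(det (1,…,k,…,1)) • ω_v(k ⊗ 1) Φ` — the open-kernel
character of ★ `FinLocalSplittings.exists_twist_omegaLoc` IS `α_v ∘ det` (on the image of `k ↦ k ⊗ 1`, which is the whole big local group,
★ `localLineInl_surjective`).  Proof: §1 at `q = (inclPlace v k, 1)` + §2 (`omegaLoc_localLineInl_eq_smul_of_Omega_finPairEmb_eq_smul`); the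
coefficient `α(det((1,k) ⊗ 1)) = α(det (1,k))` by ★ `pairDet_adelicInl`.
[cite: GelbartRogawski1991, §3.1 Prop. 3.1.1 p. 455 L1–3, Remark p. 457 L4–13] [cite: HarrisKudlaSweet1996, §1 (1.14)–(1.15)]
[cite: Liu2021, App. D §D.1 Step 2 (l. 5219), Lem. D.1 (4) (p. 126)] [cite: Weil1964, Chap. III n° 37–38 pp. 188–190] -/
theorem omegaLoc_localLineInl_eq_detTwist_smul_of_mul_ratioHecke (hΛ : θ' = θ * ratioHecke L α hc hrat)
    (v : HeightOneSpectrum (𝓞 (Fp L))) (k : UnitaryGroup.localPi L (IsCMField.complexConj L) N' (Matrix.diagonal dV₁) v)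
    (Φ : SchwartzBruhat (Fin n' → v.adicCompletion (Fp L))) :
    (congrW L e₁ dV₁ hdV₁ (lineW L TW) (complexConj_lineW L TW) (realDiagonal_lineW L TW) (diagonal_lineW L TW hJW)
        (undoubledSplittings L e₁ dV₁ hdV₁ hdV₁0 (lineW L TW) (complexConj_lineW L TW) (lineW_ne_zero L TW hWd) θ' 𝔪' 𝓕')
        hW hJW).omegaLoc v
        (UnitaryGroup.localLineInl L (IsCMField.complexConj L) N' e₁ (Matrix.diagonal dV₁) JW v k) Φ =
      ((α (UnitaryGroup.adelicDet (Fp L) L (IsCMField.complexConj L) N' (Matrix.diagonal dV₁) hJdet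
            (UnitaryGroup.finAdelicToAdelic (Fp L) L (IsCMField.complexConj L) N' (Matrix.diagonal dV₁)
              (UnitaryGroup.inclPlace (Fp L) L (IsCMField.complexConj L) N' (Matrix.diagonal dV₁) v k))) : ℂˣ) : ℂ) •
        (congrW L e₁ dV₁ hdV₁ (lineW L TW) (complexConj_lineW L TW) (realDiagonal_lineW L TW) (diagonal_lineW L TW hJW)
          (undoubledSplittings L e₁ dV₁ hdV₁ hdV₁0 (lineW L TW) (complexConj_lineW L TW) (lineW_ne_zero L TW hWd) θ 𝔪 𝓕)
          hW hJW).omegaLoc v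
          (UnitaryGroup.localLineInl L (IsCMField.complexConj L) N' e₁ (Matrix.diagonal dV₁) JW v k) Φ := by
  -- the coefficient at `q = (inclPlace v k, 1)` is `α((det k)_v)` (term mode: `(1, 1)_W ⊗-component is trivial`, ★ `pairDet_adelicInl`)
  have e1 : UnitaryGroup.adelicInr (Fp L) L (IsCMField.complexConj L) N' 1 (Matrix.diagonal dV₁) JW
        (UnitaryGroup.finAdelicToAdelic (Fp L) L (IsCMField.complexConj L) 1 JW 1) = 1 :=
    (congrArg (UnitaryGroup.adelicInr (Fp L) L (IsCMField.complexConj L) N' 1 (Matrix.diagonal dV₁) JW)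
      (map_one (UnitaryGroup.finAdelicToAdelic (Fp L) L (IsCMField.complexConj L) 1 JW))).trans
      (map_one (UnitaryGroup.adelicInr (Fp L) L (IsCMField.complexConj L) N' 1 (Matrix.diagonal dV₁) JW))
  have e3 : pairDet (Fp L) L (IsCMField.complexConj L) N' 1 e₁ (Matrix.diagonal dV₁) JW
        (det_reindex_kronecker_diagonal_line_ne_zero L e₁ dV₁ hdV₁0 TW hWd JW hJW)
        (UnitaryGroup.adelicInl (Fp L) L (IsCMField.complexConj L) N' 1 (Matrix.diagonal dV₁) JW
            (UnitaryGroup.finAdelicToAdelic (Fp L) L (IsCMField.complexConj L) N' (Matrix.diagonal dV₁)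
              (UnitaryGroup.inclPlace (Fp L) L (IsCMField.complexConj L) N' (Matrix.diagonal dV₁) v k)) *
          UnitaryGroup.adelicInr (Fp L) L (IsCMField.complexConj L) N' 1 (Matrix.diagonal dV₁) JW
            (UnitaryGroup.finAdelicToAdelic (Fp L) L (IsCMField.complexConj L) 1 JW 1)) =
      UnitaryGroup.adelicDet (Fp L) L (IsCMField.complexConj L) N' (Matrix.diagonal dV₁) hJdet
        (UnitaryGroup.finAdelicToAdelic (Fp L) L (IsCMField.complexConj L) N' (Matrix.diagonal dV₁)
          (UnitaryGroup.inclPlace (Fp L) L (IsCMField.complexConj L) N' (Matrix.diagonal dV₁) v k)) :=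
    (congrArg (pairDet (Fp L) L (IsCMField.complexConj L) N' 1 e₁ (Matrix.diagonal dV₁) JW
        (det_reindex_kronecker_diagonal_line_ne_zero L e₁ dV₁ hdV₁0 TW hWd JW hJW))
      ((congrArg (fun u => UnitaryGroup.adelicInl (Fp L) L (IsCMField.complexConj L) N' 1 (Matrix.diagonal dV₁) JW
          (UnitaryGroup.finAdelicToAdelic (Fp L) L (IsCMField.complexConj L) N' (Matrix.diagonal dV₁)
            (UnitaryGroup.inclPlace (Fp L) L (IsCMField.complexConj L) N' (Matrix.diagonal dV₁) v k)) * u) e1).trans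
        (mul_one _))).trans
      (pairDet_adelicInl (Fp L) L (IsCMField.complexConj L) N' e₁ (Matrix.diagonal dV₁) JW _ hJdet _)
  exact omegaLoc_localLineInl_eq_smul_of_Omega_finPairEmb_eq_smul (Fp L) L (IsCMField.complexConj L) N' e₁ (Matrix.diagonal dV₁) JW
    (complexConj_imagUnit L) (imagUnit_ne_zero L) (imagUnit_mul_self L) (realDiagonal_isSymm L dV₁ hdV₁) hW
    (realDiagonal_map L dV₁ hdV₁).symm hJW _ _ v k (congrArg (fun u => ((α u : ℂˣ) : ℂ)) e3)
    (fun X => Omega_finPairEmb_eq_detTwist_smul_of_mul_ratioHecke L e₁ dV₁ hdV₁ hdV₁0 θ hθu hθs hc hrat hαu θ' hθ'u hθ's TW hW hWd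
      JW hJW 𝔪 𝔪' 𝓕 𝓕' hΛ (UnitaryGroup.inclPlace (Fp L) L (IsCMField.complexConj L) N' (Matrix.diagonal dV₁) v k, 1) X) Φ

include hθu hθs hαu hθ'u hθ's in
/-- **LOCAL FORM, as an identity of representations of `U(diag dV)(L⁺_v)`** in the currency ★ `SeesawScalar.twist`:
`ω′_v ∘ (k ↦ k ⊗ 1) = (α ∘ det ∘ (1,…,·,…,1)) • (ω_v ∘ (k ↦ k ⊗ 1))`.
[cite: GelbartRogawski1991, §3.1 Remark p. 457 L4–13] [cite: Liu2021, App. D §D.1 Step 2 (l. 5219), Lem. D.1 (4) (p. 126)] -/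
theorem omegaLoc_comp_localLineInl_eq_twist_of_mul_ratioHecke (hΛ : θ' = θ * ratioHecke L α hc hrat)
    (v : HeightOneSpectrum (𝓞 (Fp L))) :
    ((congrW L e₁ dV₁ hdV₁ (lineW L TW) (complexConj_lineW L TW) (realDiagonal_lineW L TW) (diagonal_lineW L TW hJW)
        (undoubledSplittings L e₁ dV₁ hdV₁ hdV₁0 (lineW L TW) (complexConj_lineW L TW) (lineW_ne_zero L TW hWd) θ' 𝔪' 𝓕')
        hW hJW).omegaLoc v).comp
        (UnitaryGroup.localLineInl L (IsCMField.complexConj L) N' e₁ (Matrix.diagonal dV₁) JW v) =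
      SeesawScalar.twist
        (α.comp ((UnitaryGroup.adelicDet (Fp L) L (IsCMField.complexConj L) N' (Matrix.diagonal dV₁) hJdet).comp
          ((UnitaryGroup.finAdelicToAdelic (Fp L) L (IsCMField.complexConj L) N' (Matrix.diagonal dV₁)).comp
            (UnitaryGroup.inclPlace (Fp L) L (IsCMField.complexConj L) N' (Matrix.diagonal dV₁) v))))
        (((congrW L e₁ dV₁ hdV₁ (lineW L TW) (complexConj_lineW L TW) (realDiagonal_lineW L TW) (diagonal_lineW L TW hJW)
          (undoubledSplittings L e₁ dV₁ hdV₁ hdV₁0 (lineW L TW) (complexConj_lineW L TW) (lineW_ne_zero L TW hWd) θ 𝔪 𝓕)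
          hW hJW).omegaLoc v).comp
          (UnitaryGroup.localLineInl L (IsCMField.complexConj L) N' e₁ (Matrix.diagonal dV₁) JW v)) := by
  refine MonoidHom.ext fun k => LinearMap.ext fun Φ => ?_
  exact omegaLoc_localLineInl_eq_detTwist_smul_of_mul_ratioHecke L e₁ dV₁ hdV₁ hdV₁0 hJdet θ hθu hθs hc hrat hαu θ' hθ'u hθ's TW hW
    hWd JW hJW 𝔪 𝔪' 𝓕 𝓕' hΛ v k Φ

end Local

/-! ## §4 The CM COMPANION `λ ↦ λ′ = λᶜ·χ̌` at the CM θ-packages of L4if (the desk's head) -/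

section Companion

set_option maxHeartbeats 800000 in
-- measured (200 k, 400 k] on the check farm; 800 k = 2× head-room for the build lane: instantiation of §3 at the CM packages of `LemD1_4IfAsPrintedNonsplitCM₂`
/-- **B2 `omegaLoc_companion_eq_detTwist_smul` — the companion relabel is a det-twist PLACE BY PLACE.**  For a CM field `L`, a real non-zero
frame `dV`, conjugate-symplectic idèle class characters `λ, λ′` with `Λ′ = Λᶜ·χ̌` (`Λ = toHeckeCharacter L λ`), the ∀-bound twist datum
`α(u) = Λ(u)⁻¹·χ(u_f)` of R2G (★ `stub_sl_companionDetTwist_holds`), a line `a ∈ L⁺ˣ`, a finite place `v` of `L⁺` (split or not),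
`k ∈ U(diag dV)(L⁺_v)` and `Φ ∈ 𝒮((L⁺_v)^{n′})`: the local Weil factors of the two CM θ-packages OF [Liu2021, Lem. D.1 (4)] AS TYPED in
★ `LemD1RankTwoCMLetters.LemD1_4IfAsPrintedNonsplitCM₂` (`𝓢_λ,a`, `𝓢_λ′,a` = `congrW … (undoubledSplittings … (toHeckeCharacter L λ⁽′⁾)
(borelPlaceMeasure L) (cmFinLocalFamily …))`) satisfy `(𝓢_λ′,a).omegaLoc v (k ⊗ 1) Φ = α((det k)_v) • (𝓢_λ,a).omegaLoc v (k ⊗ 1) Φ`.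
Proof: §2 + ★ §1 of `F0P5CurveThetaCompanionDetTwist` (`continuous_alpha`, `alpha_eq_one_of_mem_principalIdeles`, `norm_alpha`, (T1)
`toHeckeCharacter_galConj_mul_checkOfChi_eq_mul_ratioHecke`).
[cite: Liu2021, App. D §D.1 (l. 5224), Step 2 (l. 5219), Lem. D.1 (4) (p. 126, l. 5235)] [cite: GelbartRogawski1991, §3.1 Prop. 3.1.1 p. 455 L1–3, Remark p. 457 L4–13]
[cite: HarrisKudlaSweet1996, §1 (1.14)–(1.15)] -/
theorem omegaLoc_companion_eq_detTwist_smul :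
  ∀ (L : Type) [Field L] [NumberField L] [IsCMField L]
    {N' : ℕ} (dV : Fin N' → L) (hdV : ∀ i, IsCMField.complexConj L (dV i) = dV i) (hdV0 : ∀ i, dV i ≠ 0)
    (hJdet : (Matrix.diagonal dV).det ≠ 0)
    (hcc : IsCMField.complexConj L * IsCMField.complexConj L = 1)
    {n' : ℕ} (e₁ : Fin N' × Fin 1 ≃ Fin n')
    (lam : Literature.NumberTheory.Automorphic.IdeleClassGroup L →ₜ* Circle) (hlam : IsConjugateSymplectic L lam)
    (χ : Chi (Fp L) L (IsCMField.complexConj L))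
    (lam' : Literature.NumberTheory.Automorphic.IdeleClassGroup L →ₜ* Circle) (hlam' : IsConjugateSymplectic L lam'),
    toHeckeCharacter L lam' =
      toHeckeCharacter L (IdeleClassGroup.galConj (IsCMField.complexConj L) lam) * HeckeCharacter.checkOfChi hcc χ →
    ∀ (α : UnitaryGroup.adelicOne (Fp L) L (IsCMField.complexConj L) →* ℂˣ),
      (∀ u, α u = (toHeckeCharacter L lam (u : ideleGroup L))⁻¹ *
          χ.1 ⟨finitePart L (u : ideleGroup L), finitePart_mem_finAdelicOne (Fp L) L (IsCMField.complexConj L) u.2⟩) →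
    ∀ (a : (Fp L)ˣ) (v : HeightOneSpectrum (𝓞 (Fp L)))
      (k : UnitaryGroup.localPi L (IsCMField.complexConj L) N' (Matrix.diagonal dV) v)
      (Φ : SchwartzBruhat (Fin n' → v.adicCompletion (Fp L))),
    (congrW L e₁ dV hdV (lineW L (TW (Fp L) a)) (complexConj_lineW L (TW (Fp L) a)) (realDiagonal_lineW L (TW (Fp L) a))
        (diagonal_lineW L (TW (Fp L) a) (JW_eq (Fp L) L a))
        (undoubledSplittings L e₁ dV hdV hdV0 (lineW L (TW (Fp L) a)) (complexConj_lineW L (TW (Fp L) a))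
          (lineW_ne_zero L (TW (Fp L) a) (isUnit_det_TW (Fp L) a)) (toHeckeCharacter L lam') (borelPlaceMeasure L)
          (cmFinLocalFamily L e₁ dV hdV hdV0 (lineW L (TW (Fp L) a)) (complexConj_lineW L (TW (Fp L) a))
            (lineW_ne_zero L (TW (Fp L) a) (isUnit_det_TW (Fp L) a)) (toHeckeCharacter L lam')
            ((isOscillatorChar_toHeckeCharacter_iff lam').mpr hlam') (borelPlaceMeasure L)))
        (isSymm_TW (Fp L) a) (JW_eq (Fp L) L a)).omegaLoc v
        (UnitaryGroup.localLineInl L (IsCMField.complexConj L) N' e₁ (Matrix.diagonal dV) (JW (Fp L) L a) v k) Φ =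
      ((α (UnitaryGroup.adelicDet (Fp L) L (IsCMField.complexConj L) N' (Matrix.diagonal dV) hJdet
            (UnitaryGroup.finAdelicToAdelic (Fp L) L (IsCMField.complexConj L) N' (Matrix.diagonal dV)
              (UnitaryGroup.inclPlace (Fp L) L (IsCMField.complexConj L) N' (Matrix.diagonal dV) v k))) : ℂˣ) : ℂ) •
        (congrW L e₁ dV hdV (lineW L (TW (Fp L) a)) (complexConj_lineW L (TW (Fp L) a)) (realDiagonal_lineW L (TW (Fp L) a))
          (diagonal_lineW L (TW (Fp L) a) (JW_eq (Fp L) L a))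
          (undoubledSplittings L e₁ dV hdV hdV0 (lineW L (TW (Fp L) a)) (complexConj_lineW L (TW (Fp L) a))
            (lineW_ne_zero L (TW (Fp L) a) (isUnit_det_TW (Fp L) a)) (toHeckeCharacter L lam) (borelPlaceMeasure L)
            (cmFinLocalFamily L e₁ dV hdV hdV0 (lineW L (TW (Fp L) a)) (complexConj_lineW L (TW (Fp L) a))
              (lineW_ne_zero L (TW (Fp L) a) (isUnit_det_TW (Fp L) a)) (toHeckeCharacter L lam)
              ((isOscillatorChar_toHeckeCharacter_iff lam).mpr hlam) (borelPlaceMeasure L)))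
          (isSymm_TW (Fp L) a) (JW_eq (Fp L) L a)).omegaLoc v
          (UnitaryGroup.localLineInl L (IsCMField.complexConj L) N' e₁ (Matrix.diagonal dV) (JW (Fp L) L a) v k) Φ := by
  intro L _ _ _ N' dV hdV hdV0 hJdet hcc n' e₁ lam hlam χ lam' hlam' hH α hα a v k Φ
  -- the three side conditions of the twist datum (★ §1) and (T1)
  have hc : Continuous α := continuous_alpha lam χ α hα
  have hrat : ∀ u : UnitaryGroup.adelicOne (Fp L) L (IsCMField.complexConj L),
      (u : ideleGroup L) ∈ principalIdeles L → α u = 1 := alpha_eq_one_of_mem_principalIdeles lam χ α hα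
  have hαu : ∀ u, ‖((α u : ℂˣ) : ℂ)‖ = 1 := norm_alpha lam χ α hα
  have hΛ : toHeckeCharacter L lam' = toHeckeCharacter L lam * ratioHecke L α hc hrat :=
    hH.trans (toHeckeCharacter_galConj_mul_checkOfChi_eq_mul_ratioHecke lam χ α hα hcc hc hrat)
  exact omegaLoc_localLineInl_eq_detTwist_smul_of_mul_ratioHecke L e₁ dV hdV hdV0 hJdet (toHeckeCharacter L lam)
    (isUnitary_toHeckeCharacter L lam) ((isOscillatorChar_toHeckeCharacter_iff lam).mpr hlam) hc hrat hαu (toHeckeCharacter L lam')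
    (isUnitary_toHeckeCharacter L lam') ((isOscillatorChar_toHeckeCharacter_iff lam').mpr hlam') (TW (Fp L) a) (isSymm_TW (Fp L) a)
    (isUnit_det_TW (Fp L) a) (JW (Fp L) L a) (JW_eq (Fp L) L a) (borelPlaceMeasure L) (borelPlaceMeasure L) _ _ hΛ v k Φ

end Companion

end Summit.HodgeConjecture.HodgeConjecture.Cruxes.HLiu418.F0P5CurveThetaCompanionDetTwist

end
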